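import Literature.Computability.QuantumComplexity.SolovayKitaev.Basic
import HarnessLib

/-!
# Solovay–Kitaev theorem: words over a gate set

Proof infrastructure for the discharge of
`Literature.Computability.QuantumComplexity.solovay_kitaev` (Dawson–Nielsen, QIC **6** (2006),
Theorem 1).  `WordApprox G L δ U` says that some word of length `≤ L` over the gate set
`G ⊆ SU(n)` multiplies to an element within operator-norm distance `δ` of `U`.  We record the
closure properties used by the Solovay–Kitaev recursion (Dawson–Nielsen §3):

* `WordApprox.inv` — reverse the word and invert the letters (uses inverse-closedness of `G`;
  DN §2, the remark after Definition 1);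
* `WordApprox.mul`, `WordApprox.listProd` — concatenation, errors add (all factors unitary);
* `WordApprox.comm` — the commutator word `w_V w_W w_V⁻¹ w_W⁻¹` of length `4L` approximates
  `V W V⁻¹ W⁻¹` to second order, `16 η δ + 14 δ²`, when `V, W` are within `η` of `1`
  (Dawson–Nielsen Lemma 1, here `norm_comm_sub_comm_le`).
-/

noncomputable section

open scoped Matrix.Norms.L2Operator

namespace Literature.Computability.QuantumComplexity.SolovayKitaev

open Matrix

variable {n : Type*} [Fintype n] [DecidableEq n]

/-- `WordApprox G L δ U`: some word of length at most `L` with letters in the gate set `G`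
multiplies (in `SU(n)`) to an element within `δ` of `U` in the `L²`-operator norm
(an "`δ`-approximation by an instruction sequence", Dawson–Nielsen 2006 §2). [folklore] -/
def WordApprox (G : Set (Matrix.specialUnitaryGroup n ℂ)) (L : ℕ) (δ : ℝ)
    (U : Matrix.specialUnitaryGroup n ℂ) : Prop :=
  ∃ w : List (Matrix.specialUnitaryGroup n ℂ), (∀ g ∈ w, g ∈ G) ∧ w.length ≤ L ∧
    ‖((w.prod : Matrix.specialUnitaryGroup n ℂ) : Matrix n n ℂ) - (U : Matrix n n ℂ)‖ ≤ δ

namespace WordApprox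

variable {G : Set (Matrix.specialUnitaryGroup n ℂ)} {L L' L₁ L₂ : ℕ} {δ δ' δ₁ δ₂ η : ℝ}
  {U U₁ U₂ V W : Matrix.specialUnitaryGroup n ℂ}

/-- Unfolding lemma for `WordApprox`. [folklore] -/
theorem iff_exists : WordApprox G L δ U ↔
    ∃ w : List (Matrix.specialUnitaryGroup n ℂ), (∀ g ∈ w, g ∈ G) ∧ w.length ≤ L ∧
      ‖((w.prod : Matrix.specialUnitaryGroup n ℂ) : Matrix n n ℂ) - (U : Matrix n n ℂ)‖ ≤ δ :=
  Iff.rfl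

/-- The accuracy of a word approximation is nonnegative. [folklore] -/
theorem nonneg (h : WordApprox G L δ U) : 0 ≤ δ := by
  obtain ⟨w, -, -, hd⟩ := h
  exact (norm_nonneg _).trans hd

/-- Monotonicity in the length bound and in the accuracy. [folklore] -/
theorem mono (h : WordApprox G L δ U) (hL : L ≤ L') (hδ : δ ≤ δ') : WordApprox G L' δ' U := by
  obtain ⟨w, hw, hl, hd⟩ := h
  exact ⟨w, hw, hl.trans hL, hd.trans hδ⟩

/-- A word approximating `U` exactly computes `U` when the accuracy is `0`. [folklore] -/
theorem eq_of_zero (h : WordApprox G L 0 U) :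
    ∃ w : List (Matrix.specialUnitaryGroup n ℂ), (∀ g ∈ w, g ∈ G) ∧ w.length ≤ L ∧
      w.prod = U := by
  obtain ⟨w, hw, hl, hd⟩ := h
  refine ⟨w, hw, hl, ?_⟩
  have h0 : ‖((w.prod : Matrix.specialUnitaryGroup n ℂ) : Matrix n n ℂ) - (U : Matrix n n ℂ)‖ = 0 :=
    le_antisymm hd (norm_nonneg _)
  rw [norm_eq_zero, sub_eq_zero] at h0
  exact Subtype.ext h0

/-- **Inverses** (Dawson–Nielsen §2): if `G` is closed under inverses, reversing a word and
inverting its letters approximates `U⁻¹` with the same length and accuracy. [folklore] -/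
theorem inv (hG : ∀ g ∈ G, g⁻¹ ∈ G) (h : WordApprox G L δ U) : WordApprox G L δ U⁻¹ := by
  obtain ⟨w, hw, hl, hd⟩ := h
  refine ⟨(w.map (·⁻¹)).reverse, ?_, ?_, ?_⟩
  · intro g hg
    simp only [List.mem_reverse, List.mem_map] at hg
    obtain ⟨g', hg', rfl⟩ := hg
    exact hG g' (hw g' hg')
  · simpa using hl
  · rw [← List.prod_inv_reverse, coe_inv, coe_inv, ← star_sub, norm_star]
    exact hd

/-- **Concatenation**: lengths and accuracies add (all factors are unitary). [folklore] -/
theorem mul (h₁ : WordApprox G L₁ δ₁ U₁) (h₂ : WordApprox G L₂ δ₂ U₂) :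
    WordApprox G (L₁ + L₂) (δ₁ + δ₂) (U₁ * U₂) := by
  obtain ⟨w₁, hw₁, hl₁, hd₁⟩ := h₁
  obtain ⟨w₂, hw₂, hl₂, hd₂⟩ := h₂
  refine ⟨w₁ ++ w₂, ?_, ?_, ?_⟩
  · intro g hg
    rw [List.mem_append] at hg
    rcases hg with hg | hg
    exacts [hw₁ g hg, hw₂ g hg]
  · rw [List.length_append]; exact add_le_add hl₁ hl₂
  · rw [List.prod_append, Submonoid.coe_mul, Submonoid.coe_mul]
    set P₁ : Matrix n n ℂ := ((w₁.prod : Matrix.specialUnitaryGroup n ℂ) : Matrix n n ℂ)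
    set P₂ : Matrix n n ℂ := ((w₂.prod : Matrix.specialUnitaryGroup n ℂ) : Matrix n n ℂ)
    calc ‖P₁ * P₂ - (U₁ : Matrix n n ℂ) * (U₂ : Matrix n n ℂ)‖
        = ‖(P₁ - U₁) * P₂ + (U₁ : Matrix n n ℂ) * (P₂ - U₂)‖ := by congr 1; noncomm_ring
      _ ≤ ‖(P₁ - U₁) * P₂‖ + ‖(U₁ : Matrix n n ℂ) * (P₂ - U₂)‖ := norm_add_le _ _
      _ = ‖P₁ - U₁‖ + ‖P₂ - U₂‖ := by rw [norm_mul_coe, norm_coe_mul]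
      _ ≤ δ₁ + δ₂ := add_le_add hd₁ hd₂

/-- The empty word computes `1`. [folklore] -/
theorem one : WordApprox G 0 0 (1 : Matrix.specialUnitaryGroup n ℂ) :=
  ⟨[], by simp, by simp, by simp⟩

/-- **Products of lists**: if every `X i`, `i ∈ l`, has a word of length `≤ L` and accuracy
`e i`, then `∏ X i` has a word of length `≤ |l| L` and accuracy `∑ e i`. [folklore] -/
theorem listProd {ι : Type*} (l : List ι) (X : ι → Matrix.specialUnitaryGroup n ℂ) (e : ι → ℝ)
    (L : ℕ) (h : ∀ i ∈ l, WordApprox G L (e i) (X i)) :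
    WordApprox G (l.length * L) ((l.map e).sum) (l.map X).prod := by
  induction l with
  | nil => simpa using (one (G := G))
  | cons a l ih =>
    have ha := h a (by simp)
    have ih' := ih (fun i hi => h i (by simp [hi]))
    simp only [List.map_cons, List.prod_cons, List.sum_cons, List.length_cons]
    exact (ha.mul ih').mono (le_of_eq (by ring)) le_rfl

/-- **Commutator words** (Dawson–Nielsen §3 with Lemma 1): if `G` is inverse-closed, `V, W`
are within `η` of `1`, and both have words of length `≤ L` and accuracy `δ`, then the word
`w_V w_W w_V⁻¹ w_W⁻¹` of length `≤ 4L` approximates `V W V⁻¹ W⁻¹` within `16 η δ + 14 δ²`.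
[cite: DawsonNielsen2006, Lemma 1] -/
theorem comm (hG : ∀ g ∈ G, g⁻¹ ∈ G) (hV : WordApprox G L δ V) (hW : WordApprox G L δ W)
    (hV1 : ‖(V : Matrix n n ℂ) - 1‖ ≤ η) (hW1 : ‖(W : Matrix n n ℂ) - 1‖ ≤ η) :
    WordApprox G (4 * L) (16 * η * δ + 14 * δ ^ 2) (V * W * V⁻¹ * W⁻¹) := by
  obtain ⟨wV, hwV, hlV, hdV⟩ := hV
  obtain ⟨wW, hwW, hlW, hdW⟩ := hW
  have hmem_inv : ∀ w : List (Matrix.specialUnitaryGroup n ℂ), (∀ g ∈ w, g ∈ G) →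
      ∀ g ∈ (w.map (·⁻¹)).reverse, g ∈ G := by
    intro w hw g hg
    simp only [List.mem_reverse, List.mem_map] at hg
    obtain ⟨g', hg', rfl⟩ := hg
    exact hG g' (hw g' hg')
  refine ⟨wV ++ wW ++ (wV.map (·⁻¹)).reverse ++ (wW.map (·⁻¹)).reverse, ?_, ?_, ?_⟩
  · intro g hg
    simp only [List.mem_append] at hg
    rcases hg with ((hg | hg) | hg) | hg
    exacts [hwV g hg, hwW g hg, hmem_inv wV hwV g hg, hmem_inv wW hwW g hg]
  · simp only [List.length_append, List.length_reverse, List.length_map]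
    omega
  · rw [List.prod_append, List.prod_append, List.prod_append, ← List.prod_inv_reverse,
      ← List.prod_inv_reverse]
    simp only [Submonoid.coe_mul, coe_inv]
    exact norm_comm_sub_comm_le V.2.1 W.2.1 (wV.prod).2.1 (wW.prod).2.1 hV1 hW1 hdV hdW

end WordApprox

end Literature.Computability.QuantumComplexity.SolovayKitaev
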